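import Mathlib
import Summits.NavierStokesRegularity.NavierStokesRegularity.Theorems.DssFarFieldSlavingBlowupTypeIDssProfileGaussianGapTypeI
import Summits.NavierStokesRegularity.NavierStokesRegularity.Theorems.SqueezeCycleExtremalBiaxialitySubcriticalPayerTomography
import Literature.Analysis.FluidPDE.PineauVicolPressureIdentification
import Literature.Analysis.FluidPDE.PineauVicolLerayPressure
import Literature.Analysis.FluidPDE.PineauVicolPressureDuality
import Literature.Analysis.FluidPDE.TsaiLocalPressureSup
import HarnessLib

/-!
# The Calderón–Zygmund pressure of a Type-I ancient field in similarity variables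
  (pub-ns-dss E33-CL STEP 2, pressure dictionary; route `DssFarFieldSlaving`, crux
  `BlowupTypeIDssProfile`, stmt-NavierStokesRegularity-0155 — SUPPORT; cell pub-ns-dss, typer seat g5,
  2026-08-23)

HONEST FRAMING. Bookkeeping of tree facts about the normalised (Calderón–Zygmund) pressure
`Q[v] = pressurePotential v` of the slices of a Type-I field; nothing here bears on Navier–Stokes
regularity, and nothing is numeric. For a classical representative `(V, P₀)` of the Type-I class on the
whole past (`IsClassicalNSSolutionOn (Iio 0) 1 0 V P₀`, `HasTypeIDecay C V`):

* `pressure_eq_pressurePotential_add_of_hasTypeIDecay` — Tao's Lemma 4.1 on the decay class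
  (`PineauVicol2026.pressure_sub_pressurePotential_eq_decay`, tree) moved to every `t < 0` by the window
  `[2t, t/2]`: `P₀(t) = Q[V(t)] + κ(t)` with `κ(t) = P₀(t,0) − Q[V(t)](0)`;
* `exp_mul_pressurePotential_eq` — the similarity transform of `Q[V(t)]` IS the potential of the
  similarity slice: `e^{−s} Q[V(t)](e^{−s/2} y) = Q[lerayOrbit V s](y)`, `t = −e^{−s}` (dilation
  covariance `pressurePotential_smul_comp_smul`, tree); hence
  `lerayOrbitPressure P₀ s = Q[lerayOrbit V s] + e^{−s} κ(t)` (`lerayOrbitPressure_eq_pressurePotential_add`);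
* `exists_bound_abs_pressurePotential` — a slice bound `|Q[v](x)| ≤ A (K₂C + K₁² + C²)` for `v ∈ C²`
  with `|v| ≤ C/(1+|y|)`, `‖Dv‖ ≤ K₁`, `‖D²v‖ ≤ K₂` (near part `Γ₀ ∈ L¹` against the source bound
  `abs_pressureSource_le`; far part `exists_bound_farPotential_scale_decay`, global in `x`), and its
  consequence `exists_bound_abs_pressurePotential_lerayOrbit`: `|Q[lerayOrbit V s](y)| ≤ M_P(C)` for ALL
  `s, y`, by the class-uniform scale-invariant gauge bounds
  (`typeIGauge_exists_pow_mul_norm_iteratedFDeriv_le`);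
* `exists_bound_norm_gradient_lerayOrbitPressure` — `‖∇(lerayOrbitPressure P₀ s)(y)‖ ≤ B₀(C)` for all
  `s, y` (the gauge pressure-gradient bound `exists_gauge_norm_fderiv_pressure_le_of_typeI` transported by
  `gradient_lerayOrbitPressure`).
[this file; folklore dictionary for theory/E33-CLASS-BRIDGE.md v1.2 (C2)(C3)/(S1)]
-/

noncomputable section

set_option linter.dupNamespace false
-- nested operator types `ℝ³ →L[ℝ] ℝ³ →L[ℝ] ℝ³`
set_option maxSynthPendingDepth 3

namespace Summit.NavierStokesRegularity.NavierStokesRegularity.Theorems.GaussianHeadPressure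

open Set Function Filter MeasureTheory InnerProductSpace Metric
open scoped RealInnerProductSpace Laplacian ContDiff Topology BigOperators
open Literature.Analysis Literature.Analysis.FluidPDE Literature.Analysis.FluidPDE.PineauVicol2026
open Summit.NavierStokesRegularity.NavierStokesRegularity.Theorems
open Summit.NavierStokesRegularity.NavierStokesRegularity.Theorems.BlobRiccatiClosure.TypeIApexLiouville
  (typeIGauge_exists_pow_mul_norm_iteratedFDeriv_le)
open Summit.NavierStokesRegularity.NavierStokesRegularity.Theorems.GaussianGap
  (norm_iteratedFDeriv_lerayOrbit_le norm_lerayOrbit_le_of_typeI contDiff_lerayOrbit_slice_of_typeI)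

/-! ### A slice bound for the pressure potential on the decay class -/

/-- **`|Q[v](x)| ≤ A (K₂ C + K₁² + C²)` for every `x`**, for `v ∈ C²(ℝ³)` with `|v(y)| ≤ C/(1+|y|)`,
`‖Dv‖ ≤ K₁`, `‖D²v‖ ≤ K₂` (an absolute `A`): the near part `∫ Γ₀(z) G[v](x − z) dz` is bounded by
`‖Γ₀‖_{L¹}` times the pointwise source bound `|G[v]| ≤ 2‖tr‖‖D²v‖|v| + (‖tr‖ + ‖tr‖²)‖Dv‖²`
(`abs_pressureSource_le`), the far part by `exists_bound_farPotential_scale_decay` (`≤ K C²`, all `x`).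
[folklore; tree composition] -/
theorem exists_bound_abs_pressurePotential :
    ∃ A : ℝ, 0 ≤ A ∧ ∀ (v : EuclideanSpace ℝ (Fin 3) → EuclideanSpace ℝ (Fin 3)) (C K₁ K₂ : ℝ),
      ContDiff ℝ 2 v → (∀ y, ‖v y‖ ≤ C / (1 + ‖y‖)) → (∀ y, ‖fderiv ℝ v y‖ ≤ K₁) →
      (∀ y, ‖fderiv ℝ (fderiv ℝ v) y‖ ≤ K₂) →
      ∀ x, |pressurePotential v x| ≤ A * (K₂ * C + K₁ ^ 2 + C ^ 2) := by
  obtain ⟨Kf, hKf0, hKf⟩ := exists_bound_farPotential_scale_decay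
  set N₁ : ℝ := ∫ z, |newtonNear (1 : ℝ) 2 (z : EuclideanSpace ℝ (Fin 3))| with hN₁
  have hN₁0 : 0 ≤ N₁ := integral_nonneg fun _ => abs_nonneg _
  obtain ⟨T, hT, hT0⟩ : ∃ T : ℝ,
      T = ‖(traceCLM : (EuclideanSpace ℝ (Fin 3) →L[ℝ] EuclideanSpace ℝ (Fin 3)) →L[ℝ] ℝ)‖ ∧ 0 ≤ T :=
    ⟨‖(traceCLM : (EuclideanSpace ℝ (Fin 3) →L[ℝ] EuclideanSpace ℝ (Fin 3)) →L[ℝ] ℝ)‖, rfl,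
      norm_nonneg (traceCLM : (EuclideanSpace ℝ (Fin 3) →L[ℝ] EuclideanSpace ℝ (Fin 3)) →L[ℝ] ℝ)⟩
  refine ⟨N₁ * (2 * T + (T + T ^ 2)) + Kf, by positivity, ?_⟩
  intro v C K₁ K₂ hv2 hdec hK₁ hK₂ x
  have hC0 : 0 ≤ C := by
    have h := hdec 0
    rw [norm_zero, add_zero, div_one] at h
    exact (norm_nonneg _).trans h
  have hK₂0 : 0 ≤ K₂ := le_trans (norm_nonneg (fderiv ℝ (fderiv ℝ v) 0)) (hK₂ 0)
  have hvb : ∀ y, ‖v y‖ ≤ C := fun y =>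
    (hdec y).trans (div_le_self hC0 (by linarith [norm_nonneg y]))
  -- pointwise source bound
  have hG : ∀ y, |pressureSource v y| ≤ 2 * T * (K₂ * C) + (T + T ^ 2) * K₁ ^ 2 := by
    intro y
    have h1 : ‖fderiv ℝ (fderiv ℝ v) y‖ * ‖v y‖ ≤ K₂ * C :=
      mul_le_mul (hK₂ y) (hvb y) (norm_nonneg _) hK₂0
    have h2 : ‖fderiv ℝ v y‖ ^ 2 ≤ K₁ ^ 2 := pow_le_pow_left₀ (norm_nonneg _) (hK₁ y) 2
    have h0 := abs_pressureSource_le hv2 y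
    rw [← hT] at h0
    calc |pressureSource v y|
        ≤ 2 * T * ‖fderiv ℝ (fderiv ℝ v) y‖ * ‖v y‖ + (T + T ^ 2) * ‖fderiv ℝ v y‖ ^ 2 := h0
      _ = 2 * T * (‖fderiv ℝ (fderiv ℝ v) y‖ * ‖v y‖) + (T + T ^ 2) * ‖fderiv ℝ v y‖ ^ 2 := by ring
      _ ≤ 2 * T * (K₂ * C) + (T + T ^ 2) * K₁ ^ 2 :=
          add_le_add (mul_le_mul_of_nonneg_left h1 (by positivity))
            (mul_le_mul_of_nonneg_left h2 (by positivity))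
  -- near part
  have hnear : |nearPotential 1 2 v x| ≤ N₁ * (2 * T * (K₂ * C) + (T + T ^ 2) * K₁ ^ 2) := by
    rw [nearPotential, ← Real.norm_eq_abs]
    have hGb : ∀ z : EuclideanSpace ℝ (Fin 3), ‖newtonNear 1 2 z * pressureSource v (x - z)‖ ≤
        (2 * T * (K₂ * C) + (T + T ^ 2) * K₁ ^ 2) * |newtonNear 1 2 z| := by
      intro z
      rw [norm_mul, Real.norm_eq_abs, Real.norm_eq_abs, mul_comm]
      exact mul_le_mul_of_nonneg_right (hG (x - z)) (abs_nonneg _)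
    refine (norm_integral_le_of_norm_le
      (((integrable_newtonNear zero_le_one one_lt_two).abs).const_mul _)
      (Eventually.of_forall hGb)).trans ?_
    rw [integral_const_mul, mul_comm]
  -- far part
  have hfar : |farPotential 1 2 v x| ≤ Kf * C ^ 2 := by
    have := hKf v C hv2.continuous hdec 1 le_rfl x
    simpa using this
  rw [pressurePotential]
  have hA1 : 0 ≤ N₁ * (2 * T) := by positivity
  have hA2 : 0 ≤ N₁ * (T + T ^ 2) := by positivity
  have ha : 0 ≤ K₂ * C := mul_nonneg hK₂0 hC0
  have hb : 0 ≤ K₁ ^ 2 := sq_nonneg _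
  have hd : 0 ≤ C ^ 2 := sq_nonneg _
  calc |-nearPotential 1 2 v x - farPotential 1 2 v x|
      ≤ |nearPotential 1 2 v x| + |farPotential 1 2 v x| := by
        rw [show -nearPotential 1 2 v x - farPotential 1 2 v x =
          -(nearPotential 1 2 v x + farPotential 1 2 v x) by ring, abs_neg]
        exact abs_add_le _ _
    _ ≤ N₁ * (2 * T * (K₂ * C) + (T + T ^ 2) * K₁ ^ 2) + Kf * C ^ 2 := add_le_add hnear hfar
    _ ≤ (N₁ * (2 * T + (T + T ^ 2)) + Kf) * (K₂ * C + K₁ ^ 2 + C ^ 2) := by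
        have e : (N₁ * (2 * T + (T + T ^ 2)) + Kf) * (K₂ * C + K₁ ^ 2 + C ^ 2) -
            (N₁ * (2 * T * (K₂ * C) + (T + T ^ 2) * K₁ ^ 2) + Kf * C ^ 2) =
            N₁ * (2 * T) * (K₁ ^ 2 + C ^ 2) + N₁ * (T + T ^ 2) * (K₂ * C + C ^ 2) +
              Kf * (K₂ * C + K₁ ^ 2) := by ring
        nlinarith [mul_nonneg hA1 (add_nonneg hb hd), mul_nonneg hA2 (add_nonneg ha hd),
          mul_nonneg hKf0 (add_nonneg ha hb)]

/-! ### Slice decay of a Type-I field -/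

/-- A field with the Type-I bound `‖V(t,x)‖ ≤ C/(‖x‖ + √(−t))` has, on each slice `t < 0`, the decay
`‖V(t,x)‖ ≤ (C / min 1 √(−t)) / (1 + ‖x‖)`. [folklore] -/
theorem norm_slice_le_of_hasTypeIDecay {C : ℝ}
    {V : ℝ → EuclideanSpace ℝ (Fin 3) → EuclideanSpace ℝ (Fin 3)} (hdec : HasTypeIDecay C V)
    {t : ℝ} (ht : t < 0) (x : EuclideanSpace ℝ (Fin 3)) :
    ‖V t x‖ ≤ C / min 1 (Real.sqrt (-t)) / (1 + ‖x‖) := by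
  have hδ0 : 0 < Real.sqrt (-t) := Real.sqrt_pos.2 (by linarith)
  set m : ℝ := min 1 (Real.sqrt (-t)) with hm
  have hm0 : 0 < m := lt_min one_pos hδ0
  have hC0 : 0 ≤ C := by
    have h1 := hdec t ht 0
    have hpos : 0 < ‖(0 : EuclideanSpace ℝ (Fin 3))‖ + Real.sqrt (-t) := by
      rw [norm_zero, zero_add]; exact hδ0
    exact (div_nonneg_iff.1 ((norm_nonneg _).trans h1)).elim (fun h => h.1)
      fun h => absurd h.2 (not_le.2 hpos)
  have hden : m * (1 + ‖x‖) ≤ ‖x‖ + Real.sqrt (-t) := by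
    have hm1 : m ≤ 1 := min_le_left _ _
    have hmδ : m ≤ Real.sqrt (-t) := min_le_right _ _
    nlinarith [norm_nonneg x]
  have hpos : 0 < m * (1 + ‖x‖) := by positivity
  calc ‖V t x‖ ≤ C / (‖x‖ + Real.sqrt (-t)) := hdec t ht x
    _ ≤ C / (m * (1 + ‖x‖)) := div_le_div_of_nonneg_left hC0 hpos hden
    _ = C / m / (1 + ‖x‖) := by rw [div_div]

/-! ### Tao's pressure identification on the whole past, and its similarity transform -/

/-- **The classical pressure of a Type-I field on the whole past is the Calderón–Zygmund pressure up
to a function of time**: `P₀(t, x) = Q[V(t)](x) + (P₀(t, 0) − Q[V(t)](0))` for every `t < 0`, `x`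
(Tao 2011 Lemma 4.1 on the decay class, tree lemma `pressure_sub_pressurePotential_eq_decay`, applied
on the window `[2t, t/2]` where the Type-I bound gives the decay constant `C / min(1, √(−t/2))`).
[cite: Tao2011, §4, proof of Lemma 4.1 (i)] -/
theorem pressure_eq_pressurePotential_add_of_hasTypeIDecay {C : ℝ}
    {V : ℝ → EuclideanSpace ℝ (Fin 3) → EuclideanSpace ℝ (Fin 3)}
    {P₀ : ℝ → EuclideanSpace ℝ (Fin 3) → ℝ} (hP : IsClassicalNSSolutionOn (Iio 0) 1 0 V P₀)
    (hdec : HasTypeIDecay C V) {t : ℝ} (ht : t < 0) (x : EuclideanSpace ℝ (Fin 3)) :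
    P₀ t x = pressurePotential (V t) x + (P₀ t 0 - pressurePotential (V t) 0) := by
  -- the window `[t₁, t₂] = [2t, t/2]` around `t`
  set t₁ : ℝ := 2 * t with ht₁
  set t₂ : ℝ := t / 2 with ht₂
  have h2 : t₁ < t := by rw [ht₁]; linarith
  have h3 : t < t₂ := by rw [ht₂]; linarith
  have h4 : t₂ < 0 := by rw [ht₂]; linarith
  set T : ℝ := t₂ - t₁ with hT
  have hT0 : 0 < T := by rw [hT]; linarith
  -- the translated solution on `[0, T]`
  have hsol' : IsClassicalNSSolutionOn (Icc 0 T) 1 0 (fun s => V (s + t₁)) (fun s => P₀ (s + t₁)) := by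
    have h := hP.comp_add_right t₁
    refine h.mono (fun s hs => ?_) (uniqueDiffOn_Icc hT0)
    simp only [mem_preimage, mem_Iio]
    linarith [hs.2]
  -- the decay constant on the window
  set m : ℝ := min 1 (Real.sqrt (-t₂)) with hm
  have hm0 : 0 < m := lt_min one_pos (Real.sqrt_pos.2 (by linarith))
  have hC0 : 0 ≤ C := by
    have h1 := norm_slice_le_of_hasTypeIDecay hdec ht 0
    rw [norm_zero, add_zero, div_one] at h1
    have hm' : 0 < min 1 (Real.sqrt (-t)) := lt_min one_pos (Real.sqrt_pos.2 (by linarith))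
    exact (div_nonneg_iff.1 ((norm_nonneg _).trans h1)).elim (fun h => h.1)
      fun h => absurd h.2 (not_le.2 hm')
  have hdec' : ∀ s ∈ Icc 0 T, ∀ y, ‖V (s + t₁) y‖ ≤ C / m / (1 + ‖y‖) := by
    intro s hs y
    have hτ : s + t₁ < 0 := by linarith [hs.2]
    have hτ2 : -t₂ ≤ -(s + t₁) := by linarith [hs.2]
    have hmle : m ≤ min 1 (Real.sqrt (-(s + t₁))) :=
      le_min (min_le_left _ _) ((min_le_right _ _).trans (Real.sqrt_le_sqrt hτ2))
    calc ‖V (s + t₁) y‖ ≤ C / min 1 (Real.sqrt (-(s + t₁))) / (1 + ‖y‖) :=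
          norm_slice_le_of_hasTypeIDecay hdec hτ y
      _ ≤ C / m / (1 + ‖y‖) := by
          gcongr
  have key := pressure_sub_pressurePotential_eq_decay zero_le_one hsol' (by positivity) hdec'
    (t := t - t₁) ⟨by linarith, by rw [hT]; linarith⟩ x
  simp only [sub_add_cancel] at key
  linarith

/-- **The similarity transform of the Calderón–Zygmund pressure is the potential of the similarity
slice**: `e^{−s} Q[V(t)](e^{−s/2} y) = Q[lerayOrbit V s](y)`, `t = −e^{−s}`, for a `C²` slice with Type-I
decay (dilation covariance `pressurePotential_smul_comp_smul` at `λ = e^{−s/2}`). [folklore] -/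
theorem exp_mul_pressurePotential_eq {C : ℝ}
    {V : ℝ → EuclideanSpace ℝ (Fin 3) → EuclideanSpace ℝ (Fin 3)} (hdec : HasTypeIDecay C V) (s : ℝ)
    (hV2 : ContDiff ℝ 2 (V (-Real.exp (-s)))) (y : EuclideanSpace ℝ (Fin 3)) :
    Real.exp (-s) * pressurePotential (V (-Real.exp (-s))) (Real.exp (-s / 2) • y) =
      pressurePotential (lerayOrbit V s) y := by
  have ht : -Real.exp (-s) < 0 := neg_neg_of_pos (Real.exp_pos _)
  have hlam : 0 < Real.exp (-s / 2) := Real.exp_pos _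
  have e : lerayOrbit V s =
      fun z => Real.exp (-s / 2) • V (-Real.exp (-s)) (Real.exp (-s / 2) • z) := by
    funext z; rw [lerayOrbit_apply]
  rw [e, pressurePotential_smul_comp_smul hV2 (fun z => norm_slice_le_of_hasTypeIDecay hdec ht z) hlam y,
    exp_neg_half_sq]

/-- **The similarity pressure of a classical Type-I representative is the potential of the similarity
velocity up to a function of `s`**: `lerayOrbitPressure P₀ s y = Q[lerayOrbit V s](y) + e^{−s} κ(t)`,
`κ(t) = P₀(t,0) − Q[V(t)](0)`, `t = −e^{−s}`. [cite: Tao2011, §4, proof of Lemma 4.1 (i)] -/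
theorem lerayOrbitPressure_eq_pressurePotential_add {C : ℝ}
    {V : ℝ → EuclideanSpace ℝ (Fin 3) → EuclideanSpace ℝ (Fin 3)}
    {P₀ : ℝ → EuclideanSpace ℝ (Fin 3) → ℝ} (hP : IsClassicalNSSolutionOn (Iio 0) 1 0 V P₀)
    (hdec : HasTypeIDecay C V) (s : ℝ) (y : EuclideanSpace ℝ (Fin 3)) :
    lerayOrbitPressure P₀ s y = pressurePotential (lerayOrbit V s) y +
      Real.exp (-s) * (P₀ (-Real.exp (-s)) 0 - pressurePotential (V (-Real.exp (-s))) 0) := by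
  have ht : -Real.exp (-s) < 0 := neg_neg_of_pos (Real.exp_pos _)
  have hV2 : ContDiff ℝ 2 (V (-Real.exp (-s))) :=
    (hP.contDiff_velocity (show -Real.exp (-s) ∈ Iio (0 : ℝ) from ht)).of_le (by norm_cast)
  rw [lerayOrbitPressure_apply, pressure_eq_pressurePotential_add_of_hasTypeIDecay hP hdec ht, mul_add,
    exp_mul_pressurePotential_eq hdec s hV2 y]

/-! ### Uniform bounds in `s` -/

/-- **The Calderón–Zygmund pressure of the similarity slices is bounded, uniformly in `s` and `y`**:
for `IsTypeIAncientMild C V` with `HasTypeIDecay C V`, `|Q[lerayOrbit V s](y)| ≤ M_P` with `M_P`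
depending on `C` only (slice bound `exists_bound_abs_pressurePotential` with the class-uniform
scale-invariant gauge bounds `‖DᵏlerayOrbit V s‖ ≤ K_k`, `k = 1, 2`, and the profile decay
`(1+|y|)|lerayOrbit V s y| ≤ C`). [folklore; tree composition] -/
theorem exists_bound_abs_pressurePotential_lerayOrbit (C : ℝ) :
    ∃ M : ℝ, 0 ≤ M ∧ ∀ ⦃V : ℝ → EuclideanSpace ℝ (Fin 3) → EuclideanSpace ℝ (Fin 3)⦄,
      IsTypeIAncientMild C V → HasTypeIDecay C V →
      ∀ (s : ℝ) (y : EuclideanSpace ℝ (Fin 3)), |pressurePotential (lerayOrbit V s) y| ≤ M := by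
  obtain ⟨A, hA0, hA⟩ := exists_bound_abs_pressurePotential
  obtain ⟨K₁, hK₁⟩ := typeIGauge_exists_pow_mul_norm_iteratedFDeriv_le C 1
  obtain ⟨K₂, hK₂⟩ := typeIGauge_exists_pow_mul_norm_iteratedFDeriv_le C 2
  refine ⟨A * (|K₂| * |C| + K₁ ^ 2 + C ^ 2), by positivity, fun V hT hdec s y => ?_⟩
  have hW2 : ContDiff ℝ 2 (lerayOrbit V s) := contDiff_lerayOrbit_slice_of_typeI hT s (by norm_cast)
  have hWdec : ∀ z, ‖lerayOrbit V s z‖ ≤ C / (1 + ‖z‖) := fun z => by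
    rw [add_comm]; exact hdec.norm_lerayOrbit_le s z
  have b1 : ∀ z, ‖fderiv ℝ (lerayOrbit V s) z‖ ≤ K₁ := fun z => by
    rw [← norm_iteratedFDeriv_one]; exact norm_iteratedFDeriv_lerayOrbit_le hT hK₁ s z
  have b2 : ∀ z, ‖fderiv ℝ (fderiv ℝ (lerayOrbit V s)) z‖ ≤ K₂ := fun z => by
    rw [← norm_iteratedFDeriv_one, norm_iteratedFDeriv_fderiv]
    exact norm_iteratedFDeriv_lerayOrbit_le hT hK₂ s z
  refine (hA _ C K₁ K₂ hW2 hWdec b1 b2 y).trans (mul_le_mul_of_nonneg_left ?_ hA0)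
  have : K₂ * C ≤ |K₂| * |C| := by rw [← abs_mul]; exact le_abs_self _
  linarith

/-- **The gradient of the similarity pressure of a classical Type-I representative is bounded,
uniformly in `s` and `y`**: `‖∇(lerayOrbitPressure P₀ s)(y)‖ ≤ B₀(C)` (the class-uniform gauge bound
`√(−t)³‖∇P₀(t)‖ ≤ B₀` of `exists_gauge_norm_fderiv_pressure_le_of_typeI` and the chain rule
`gradient_lerayOrbitPressure`). [cite: KochNadirashviliSereginSverak2009, Prop. 4.1 (4.10)–(4.11) (arXiv:0709.3599v1 p. 8)] -/
theorem exists_bound_norm_gradient_lerayOrbitPressure (C : ℝ) :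
    ∃ B : ℝ, 0 ≤ B ∧ ∀ ⦃V : ℝ → EuclideanSpace ℝ (Fin 3) → EuclideanSpace ℝ (Fin 3)⦄,
      IsTypeIAncientMild C V → ∀ (P₀ : ℝ → EuclideanSpace ℝ (Fin 3) → ℝ),
      IsClassicalNSSolutionOn (Iio 0) 1 0 V P₀ →
      ∀ (s : ℝ) (y : EuclideanSpace ℝ (Fin 3)), ‖gradient (lerayOrbitPressure P₀ s) y‖ ≤ B := by
  obtain ⟨B₀, hB₀0, hB₀⟩ := exists_gauge_norm_fderiv_pressure_le_of_typeI C
  refine ⟨B₀, hB₀0, fun V hT P₀ hP s y => ?_⟩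
  have ht : -Real.exp (-s) < 0 := neg_neg_of_pos (Real.exp_pos _)
  have hP' : IsClassicalNSSolutionOn (Ioo (-Real.exp (-s) - 1) 0) 1 0 V P₀ :=
    hP.mono (fun τ hτ => hτ.2) (isOpen_Ioo.uniqueDiffOn)
  have key := hB₀ hT (-Real.exp (-s) - 1) P₀ hP' (-Real.exp (-s)) (by linarith) ht
    (Real.exp (-s / 2) • y)
  have hsq : Real.sqrt (-(-Real.exp (-s))) = Real.exp (-s / 2) := by
    rw [neg_neg]; exact sqrt_exp_neg s
  rw [hsq] at key
  rw [gradient_lerayOrbitPressure, lerayOrbitForce_apply, norm_smul, norm_pow,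
    Real.norm_of_nonneg (Real.exp_pos _).le, gradient, LinearIsometryEquiv.norm_map]
  exact key

/-! ### The trace Poisson equation in a rotated frame -/

/-- **The coordinate form of the pressure Poisson equation is `O(3)`-invariant**: if
`∑ₗ ∂ₗ∂ₗQ = −∑ₗⱼ ∂ₗWⱼ ∂ⱼWₗ` at every point (`W ∈ C¹`, `Q ∈ C²`), then the conjugated pair
`Ũ = R ∘ W ∘ R⁻¹`, `Q̃ = Q ∘ R⁻¹` satisfies the same identity, for every linear isometry `R` of `ℝ³`
(both sides are basis free: `ΔQ̃ = (ΔQ) ∘ R⁻¹` by `laplacian_comp_linearIsometryEquiv_symm`, and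
`∑ₗⱼ ∂ₗWⱼ ∂ⱼWₗ = tr((DW)²)` by `traceCLM_comp_self_eq_sum_sum`, with `DŨ = R ∘ DW ∘ R⁻¹`).
The conjugated pair is given pointwise (`Wc`, `Qc`), so that the lemma applies to slices of curried
fields. [folklore] -/
theorem sum_pderiv_pderiv_conj_linearIsometryEquiv
    (R : EuclideanSpace ℝ (Fin 3) ≃ₗᵢ[ℝ] EuclideanSpace ℝ (Fin 3))
    {W Wc : EuclideanSpace ℝ (Fin 3) → EuclideanSpace ℝ (Fin 3)} {Q Qc : EuclideanSpace ℝ (Fin 3) → ℝ}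
    (hW : Differentiable ℝ W) (hQ : ContDiff ℝ 2 Q)
    (h : ∀ x, ∑ l, pderiv l (pderiv l Q) x =
      -∑ l, ∑ j, pderiv l (fun z => W z j) x * pderiv j (fun z => W z l) x)
    (hWc : ∀ y, Wc y = R (W (R.symm y))) (hQc : ∀ y, Qc y = Q (R.symm y))
    (z : EuclideanSpace ℝ (Fin 3)) :
    ∑ l, pderiv l (pderiv l Qc) z =
      -∑ l, ∑ j, pderiv l (fun y => Wc y j) z * pderiv j (fun y => Wc y l) z := by
  obtain rfl : Wc = fun y => R (W (R.symm y)) := funext hWc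
  obtain rfl : Qc = fun y => Q (R.symm y) := funext hQc
  -- components of derivatives
  have hD : ∀ (v : EuclideanSpace ℝ (Fin 3) → EuclideanSpace ℝ (Fin 3)) (x : EuclideanSpace ℝ (Fin 3)),
      DifferentiableAt ℝ v x → ∀ j i : Fin 3,
        fderiv ℝ v x (EuclideanSpace.single j 1) i = pderiv j (fun y => v y i) x := by
    intro v x hv j i
    rw [pderiv_apply, euclidean_fderiv_apply_comp hv]
  -- the double sums are traces of squares
  have hsum : ∀ (v : EuclideanSpace ℝ (Fin 3) → EuclideanSpace ℝ (Fin 3)) (x : EuclideanSpace ℝ (Fin 3)),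
      DifferentiableAt ℝ v x →
        ∑ l, ∑ j, pderiv l (fun y => v y j) x * pderiv j (fun y => v y l) x =
          traceCLM ((fderiv ℝ v x).comp (fderiv ℝ v x)) := by
    intro v x hv
    rw [traceCLM_comp_self_eq_sum_sum (EuclideanSpace.basisFun (Fin 3) ℝ)]
    refine Finset.sum_congr rfl fun l _ => Finset.sum_congr rfl fun j _ => ?_
    simp only [EuclideanSpace.basisFun_apply, EuclideanSpace.inner_single_left, map_one, one_mul,
      hD v x hv]
    ring
  -- the conjugated field and its derivative
  set x : EuclideanSpace ℝ (Fin 3) := R.symm z with hx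
  have hUd : DifferentiableAt ℝ (fun y => R (W (R.symm y))) z :=
    (R.differentiable.comp (hW.comp R.symm.differentiable)) z
  have hDU : fderiv ℝ (fun y => R (W (R.symm y))) z =
      (R : EuclideanSpace ℝ (Fin 3) →L[ℝ] EuclideanSpace ℝ (Fin 3)).comp ((fderiv ℝ W x).comp
        (R.symm : EuclideanSpace ℝ (Fin 3) →L[ℝ] EuclideanSpace ℝ (Fin 3))) :=
    fderiv_conj_linearIsometryEquiv R W z
  -- trace invariance under conjugation
  have htr : traceCLM ((fderiv ℝ (fun y => R (W (R.symm y))) z).comp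
      (fderiv ℝ (fun y => R (W (R.symm y))) z)) = traceCLM ((fderiv ℝ W x).comp (fderiv ℝ W x)) := by
    rw [hDU, traceCLM_comp_self_eq_sum_sum ((EuclideanSpace.basisFun (Fin 3) ℝ).map R),
      traceCLM_comp_self_eq_sum_sum (EuclideanSpace.basisFun (Fin 3) ℝ)]
    refine Finset.sum_congr rfl fun i _ => Finset.sum_congr rfl fun j _ => ?_
    simp only [OrthonormalBasis.map_apply, ContinuousLinearMap.coe_comp, Function.comp_apply,
      LinearIsometryEquiv.coe_coe'', LinearIsometryEquiv.symm_apply_apply,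
      LinearIsometryEquiv.inner_map_map]
  -- the scalar side
  have hQc : ContDiff ℝ 2 (fun y => Q (R.symm y)) := hQ.comp R.symm.contDiff
  rw [← laplacian_eq_sum_pderiv_pderiv' hQc z, laplacian_comp_linearIsometryEquiv_symm R Q z,
    laplacian_eq_sum_pderiv_pderiv' hQ, ← hx, h x, hsum W x (hW x), ← htr, ← hsum _ z hUd]

end Summit.NavierStokesRegularity.NavierStokesRegularity.Theorems.GaussianHeadPressure

end
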